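import Summits.QuantumFields.YangMills.Theorems.BalabanUVNodesN18TwoRunLettersCalculusInvLoc
import Summits.QuantumFields.YangMills.Theorems.BalabanUVNodesN18TwoRunLettersCalculusSqrtLoc

/-!
# BalabanUVNodes ∕ N18 — THE TWO-RUN CLOSENESS-LETTER CALCULUS, PART 5 (COMPOSITE SHAPES, END TO END): the END's two-run closeness binders of
# `N18TwoRunLetters.termWalkData_of_staticLetters_at_window` for the two composite shapes of [Balaban1988RG2Cluster] (2.7)∕(2.14) — «local factor ×
# (precision)^{−1/2}» (`Γ_k = C*Δ_k(σ)C·(C^{(k)})^{1/2}`, `(C^{(k)})^{1/2} = (C*Δ_kC)^{−1/2}`; (C2) here, (C1) = part 2 §6) and «local factor × (precision)⁻¹»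
# (every propagator-carrying factor `G(σ) = Δ(σ)⁻¹`; (C1) and (C2) here) — from the letters of their PRIMITIVES; companion of parts 1–4 (`…Calculus`,
# `…CalculusResolvent`, `…CalculusInvLoc`, `…CalculusSqrtLoc`) (Track A, DAG node N18 = NE5 `T4OutputRate.NE5 EA EB W κ θ C₅`; cluster K4 «SpineRates»)

Cell `pub-ymgap`, HUMAN RULING D-0149 (T⁴ apex work-bound push), width seat `pub-ymgap-dag-n18-w1` (g0); W-SEAT-START-LIST v3 §2 n18 item 1
(«`N18At` at the record … start from `…N18EndLetters` ∕ `…N18TwoRunLetters` currency»), SUB-LEMMA «two-run closeness-letter calculus», part 5.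
`--kind proof --supports stmt-QuantumFields-20544` (K3⁷ `SpineGivenEndpointR13SepCoPH`) as a HELPER — COUNT-NEUTRAL.

HONEST FRAMING.  Finite-matrix bookkeeping; THEOREMS ONLY, 0 `def`, 0 `sorry`, standard axioms.  Every letter is a HYPOTHESIS about abstract
static families (a local factor `σ ↦ K(σ)`, a precision `σ ↦ P(σ)`); nothing of Bałaban's `Γ_k`, `Δ^{(k)}(Z₀,σ,𝐔,𝐉)`, `C^{(k)}`, `(C^{(k)})^{1/2}` is constructed
or asserted; the PRIMITIVE two-run closeness letters (rows NE2∕NE3's η-rate for Bałaban's operators at two lattice spacings; NODE O 0∕1) are NOT supplied;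
NE5 NOT IN PRINT ([Balaban1987RG1] Thm 1 p. 259) and NOT PROVED; N18 NOT discharged; counts UNMOVED (typed 28∕28 · discharged 5∕27); one finite
four-torus programme at fixed ε — NOT continuum, NOT ℝ⁴, NOT OS, NOT a mass gap, NOT Clay.
A6 ∕ SATISFIABILITY (№189).  The displayed hypotheses of every theorem below are JOINTLY SATISFIABLE — e.g. identical runs (`K_A = K_B`, `A_A = A_B`,
`P_A = P_B`, rate `ϱ = 0`) with constant-in-σ families, the precision `P(σ) := m·1` (range one, `m`-accretive, off-diagonal sums `0`), any `X ≠ ∅` — so no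
statement is vacuous; they carry CONTENT only when instantiated at Bałaban's primitives with rows NE2∕NE3's rate, which this file does not do.

WHAT:
* §9 ★ `locClose_mul_invSqrt` — (C2) of `σ ↦ K(σ)·(P(σ))^{−1/2}` = part 1 `locClose_mul` fed with the LOCAL FACTOR's four letters ((L1) `B_K`, (L2) `B_K′`,
  (C1) `D_K`, (C2) `D_K′`) and, for the SQUARE ROOT of the `m`-accretive range-one precision: (L1) `2∕√m` (`B13Sqrt27Accretive.norm_invSqrt_apply_le`), (L2)
  `4B₀c_{V,d}²∕(m√m)` (`norm_invSqrt_sub_apply_le` at `T := P_B(σ), T′ := P_B(0)`, weight `d_X∕s` through `X`), (C1) `4B_Ec_{V,d}²∕(m√m)` (part 2 `close_invSqrt`),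
  (C2) `16B_EB₀c_V⁴∕(m²√m) + 4D_E′c_V²∕(m√m)` (part 4 `locClose_invSqrt`).  All input letters at ONE decay `ρ` in located `d₁` ∕ `d_X` currency with
  `ρ·s + η_d ≤ θ`; volume sums `c_V` (margin `η`, `d₁`-currency: rows of `p`, rows and columns of `Λ`) and `c_{V,d}` (margin `η_d`, bond pseudo-metric);
  output decay `ρ_f` with `ρ_f + 5η ≤ ρ`; amplitude `(D_K′·(2∕√m) + B_K′·(4B_Ec_{V,d}²∕(m√m)) + D_K·(4B₀c_{V,d}²∕(m√m)) + B_K·(16B_EB₀c_V⁴∕(m²√m) +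
  4D_E′c_V²∕(m√m)))·c_V`.
* §10 ★ `close_mul_inv` ∕ ★ `locClose_mul_inv` — (C1) ∕ (C2) of `σ ↦ K(σ)·(A(σ))⁻¹` = part 1 `close_mul` ∕ `locClose_mul` ∘ {local factor's letters} ∘
  {inverse: (L1) = NODE O's (L4) `B_C`; (L2) `B_C²B_E′c_V²` (resolvent identity `A(σ)⁻¹ − A(0)⁻¹ = A(σ)⁻¹(A(0) − A(σ))A(0)⁻¹` through `X`, part 1 §1);
  (C1) part 2 `close_inv`; (C2) part 3 `locClose_inv`}; output decay `ρ_f + 3η ≤ ρ` resp. `ρ_f + 5η ≤ ρ`; amplitudes `(D_K·B_C + B_K·(B_C²D_Ec_V²))·c_V` and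
  `(D_K′·B_C + B_K′·(B_C²D_Ec_V²) + D_K·(B_C²B_E′c_V²) + B_K·(2B_C³B_E′D_Ec_V⁴ + B_C²D_E′c_V²))·c_V`.
So BOTH Γ-slot binders of the END (`hcloseΓ`: part 2 §6; `hlocΓ`: here) follow BY NAME from primitive letters of the local factor and of the precision;
the precision-slot binders (`hcloseE hlocE`: sums ∕ products of primitives, parts 1–2; `hC4`: NODE O's (L4)) likewise.  What remains for N18 = NE5
at the record through «the END from letters» is exactly the PRIMITIVES' letters at the window rate `ϱ_j ≤ C₂θ^j` — rows NE2∕NE3 ∕ NODE O.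
NOT COVERED (honest): those primitives; the END's other binders (σ-holomorphy, symmetry, potentials, (L5), numerics).

Sources (mechanism and shapes only; nothing printed is asserted): T. Bałaban, CMP **116** (1988) [Balaban1988RG2Cluster] (1.11) p. 5, (2.7) p. 13, p. 15,
(2.14)–(2.16) p. 16; CMP **99** (1985) [Balaban1985BackgroundPropagators] (3.93) p. 410, Thm 3.10 p. 416; C. King, CMP **102** (1986) [King1986] p. 665 («the
error is the same graph with a difference of propagators on one line»).  Nothing here is a claim about the Yang–Mills mass gap.
-/

noncomputable section

namespace Summit.QuantumFields.YangMills.BalabanUVNodes.N18TwoRunLettersCalculusGammaLoc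

open Metric Set Finset
open scoped Matrix
open Literature.MathematicalPhysics.QuantumFieldTheory.Balaban1983to89
open Literature.MathematicalPhysics.QuantumFieldTheory.Balaban1983to89.B9Thm37GlueTorus (tdist1 tdist1_nonneg)
open Literature.MathematicalPhysics.QuantumFieldTheory.Balaban1983to89.TreeLengthTorus (TPt)
open Literature.MathematicalPhysics.QuantumFieldTheory.Balaban1983to89.B5TorusCover (UT)
open Literature.MathematicalPhysics.QuantumFieldTheory.Balaban1983to89.NodeOLetters (distX distX_nonneg)
open Literature.MathematicalPhysics.QuantumFieldTheory.Balaban1983to89.NodeOLettersSqrt (distX_le_tdist1_add)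
open Literature.MathematicalPhysics.QuantumFieldTheory.Balaban1983to89.B13Sqrt27Accretive (invSqrt norm_invSqrt_apply_le norm_invSqrt_sub_apply_le)
open Summit.QuantumFields.YangMills.BalabanUVNodes.N18TwoRunLettersCalculus
  (close_mul locClose_mul norm_mul_apply_le_of_decayX_left norm_mul_apply_le_of_decayX_right)
open Summit.QuantumFields.YangMills.BalabanUVNodes.N18TwoRunLettersCalculusResolvent (close_inv close_invSqrt)
open Summit.QuantumFields.YangMills.BalabanUVNodes.N18TwoRunLettersCalculusInvLoc (locClose_inv)
open Summit.QuantumFields.YangMills.BalabanUVNodes.N18TwoRunLettersCalculusSqrtLoc (locClose_invSqrt)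

variable {d N' : ℕ} {ν : ℕ} {Nf : Fin ν → ℕ} [∀ i, NeZero (Nf i)]

omit [∀ i, NeZero (Nf i)] in
/-- `σ = 0` lies in the polydisc `‖σ_j‖ ≤ e^{κ₁}` (plumbing). [folklore] -/
private theorem zero_mem_polydisc' (c : B13.Consts) : ∀ j, ‖(0 : TPt d N' → ℂ) j‖ ≤ Real.exp c.κ₁ :=
  fun _ => by simpa using (Real.exp_pos c.κ₁).le

/-! ## §9 THE Γ-KERNEL SHAPE, SECOND ORDER: (C2) of `σ ↦ K(σ)·(P(σ))^{−1/2}` end to end — the END's `hlocΓ` binder for «local factor × square root» -/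

section GammaLoc

variable {p Λ : Type} [Fintype Λ] [DecidableEq Λ] {c : B13.Consts}

/-- **(C2) OF THE Γ-KERNEL SHAPE `σ ↦ K(σ)·(P(σ))^{−1/2}`, END TO END** — part 1 `locClose_mul` fed with: the LOCAL FACTOR's four letters ((L1) `B_K`,
(L2) `B_K′`, (C1) `D_K`, (C2) `D_K′`); for the SQUARE ROOT of the precision: (L1) `2∕√m` (`norm_invSqrt_apply_le`), (L2) `4B₀c_{V,d}²∕(m√m)`
(`norm_invSqrt_sub_apply_le` at `T := P_B(σ), T′ := P_B(0)`, weight `d_X∕s`), (C1) `4B_Ec_{V,d}²∕(m√m)` (part 2 `close_invSqrt`), (C2)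
`16B_EB₀c_V⁴∕(m²√m) + 4D_E′c_V²∕(m√m)` (part 4 `locClose_invSqrt`).  All input letters at ONE decay `ρ` (located `d₁` ∕ `d_X` currency) with
`ρ·s + η_d ≤ θ`; volume sums `c_V` at margin `η` in `d₁`-currency (rows of `p`, rows and columns of `Λ`) and `c_{V,d}` at margin `η_d` in the bond
pseudo-metric `dist`; output decay `ρ_f` with `ρ_f + 5η ≤ ρ`; amplitude
`(D_K′·(2∕√m) + B_K′·(4B_Ec_{V,d}²∕(m√m)) + D_K·(4B₀c_{V,d}²∕(m√m)) + B_K·(16B_EB₀c_V⁴∕(m²√m) + 4D_E′c_V²∕(m√m)))·c_V`.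
This is the `hlocΓ` binder of `N18TwoRunLetters.termWalkData_of_staticLetters_at_window` for a Γ-kernel read as «local factor × square root of the
covariance» ([Balaban1988RG2Cluster] p. 13) from the letters of its PRIMITIVES (local factor, precision) — which are rows NE2∕NE3's ∕ NODE O's content and
are NOT supplied here. [cite: Balaban1988RG2Cluster, (2.7) p.13, p.15, (2.14)–(2.16) p.16; Balaban1985BackgroundPropagators, (3.93) p.410, Thm 3.10 p.416; King1986, p.665] -/
theorem locClose_mul_invSqrt (locp : p → UT Nf) (locΛ : Λ → UT Nf)
    (KA KB : (TPt d N' → ℂ) → Matrix p Λ ℂ) (PA PB : (TPt d N' → ℂ) → Matrix Λ Λ ℂ)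
    (dist : Λ → Λ → ℕ) (hd0 : ∀ i, dist i i = 0) (hds : ∀ i j, dist i j = dist j i)
    (hdt : ∀ i j k, dist i k ≤ dist i j + dist j k)
    {s : ℝ} (hs : 0 < s) (hloc : ∀ i j, tdist1 Nf (locΛ i) (locΛ j) ≤ s * dist i j) {X : Finset (UT Nf)} (hX : X.Nonempty)
    {h m θ η ηd cV cVd BE B₀ DE' BK BK' DK DK' ρ ρf ϱ : ℝ} (hm : 0 < m) (hθ : 0 ≤ θ) (hhθ : h * (Real.exp θ - 1) ≤ m / 2)
    (hBE : 0 ≤ BE) (hB₀ : 0 ≤ B₀) (hDE' : 0 ≤ DE') (hBK : 0 ≤ BK) (hBK' : 0 ≤ BK') (hDK : 0 ≤ DK) (hDK' : 0 ≤ DK') (hϱ : 0 ≤ ϱ)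
    (hηd : 0 ≤ ηd) (hρθ : ρ * s + ηd ≤ θ) (hρf : 0 ≤ ρf) (hη : 0 ≤ η) (hsplit : ρf + 5 * η ≤ ρ)
    -- the local factor: (L1), (L2) of run A; (C1), (C2) of the pair — at decay `ρ`
    (hKA : ∀ σ : TPt d N' → ℂ, (∀ j, ‖σ j‖ ≤ Real.exp c.κ₁) →
      ∀ i k, ‖KA σ i k‖ ≤ BK * Real.exp (-(ρ * tdist1 Nf (locp i) (locΛ k))))
    (hKA' : ∀ σ : TPt d N' → ℂ, (∀ j, ‖σ j‖ ≤ Real.exp c.κ₁) →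
      ∀ i k, ‖KA σ i k - KA 0 i k‖ ≤ BK' * Real.exp (-(ρ * distX X (locp i) (locΛ k))))
    (hKclose : ∀ σ : TPt d N' → ℂ, (∀ j, ‖σ j‖ ≤ Real.exp c.κ₁) →
      ∀ i k, ‖KB σ i k - KA σ i k‖ ≤ ϱ * (DK * Real.exp (-(ρ * tdist1 Nf (locp i) (locΛ k)))))
    (hKloc : ∀ σ : TPt d N' → ℂ, (∀ j, ‖σ j‖ ≤ Real.exp c.κ₁) →
      ∀ i k, ‖(KB σ i k - KB 0 i k) - (KA σ i k - KA 0 i k)‖ ≤ ϱ * (DK' * Real.exp (-(ρ * distX X (locp i) (locΛ k)))))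
    -- the precisions: accretive range-one data, (L2) of both runs, (C1), (C2) of the pair — at decay `ρ`
    (hrangeA : ∀ σ : TPt d N' → ℂ, (∀ j, ‖σ j‖ ≤ Real.exp c.κ₁) → ∀ i j, PA σ i j ≠ 0 → dist i j ≤ 1)
    (hrangeB : ∀ σ : TPt d N' → ℂ, (∀ j, ‖σ j‖ ≤ Real.exp c.κ₁) → ∀ i j, PB σ i j ≠ 0 → dist i j ≤ 1)
    (hrowA : ∀ σ : TPt d N' → ℂ, (∀ j, ‖σ j‖ ≤ Real.exp c.κ₁) → ∀ i, ∑ j ∈ univ.filter (fun j => dist i j ≠ 0), ‖PA σ i j‖ ≤ h)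
    (hcolA : ∀ σ : TPt d N' → ℂ, (∀ j, ‖σ j‖ ≤ Real.exp c.κ₁) → ∀ j, ∑ i ∈ univ.filter (fun i => dist i j ≠ 0), ‖PA σ i j‖ ≤ h)
    (hrowB : ∀ σ : TPt d N' → ℂ, (∀ j, ‖σ j‖ ≤ Real.exp c.κ₁) → ∀ i, ∑ j ∈ univ.filter (fun j => dist i j ≠ 0), ‖PB σ i j‖ ≤ h)
    (hcolB : ∀ σ : TPt d N' → ℂ, (∀ j, ‖σ j‖ ≤ Real.exp c.κ₁) → ∀ j, ∑ i ∈ univ.filter (fun i => dist i j ≠ 0), ‖PB σ i j‖ ≤ h)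
    (haccA : ∀ σ : TPt d N' → ℂ, (∀ j, ‖σ j‖ ≤ Real.exp c.κ₁) →
      ∀ v : Λ → ℂ, m * ∑ i, ‖v i‖ ^ 2 ≤ (∑ i, star (v i) * (PA σ *ᵥ v) i).re)
    (haccB : ∀ σ : TPt d N' → ℂ, (∀ j, ‖σ j‖ ≤ Real.exp c.κ₁) →
      ∀ v : Λ → ℂ, m * ∑ i, ‖v i‖ ^ 2 ≤ (∑ i, star (v i) * (PB σ *ᵥ v) i).re)
    (hPA' : ∀ σ : TPt d N' → ℂ, (∀ j, ‖σ j‖ ≤ Real.exp c.κ₁) →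
      ∀ k l, ‖PA σ k l - PA 0 k l‖ ≤ B₀ * Real.exp (-(ρ * distX X (locΛ k) (locΛ l))))
    (hPB' : ∀ σ : TPt d N' → ℂ, (∀ j, ‖σ j‖ ≤ Real.exp c.κ₁) →
      ∀ k l, ‖PB σ k l - PB 0 k l‖ ≤ B₀ * Real.exp (-(ρ * distX X (locΛ k) (locΛ l))))
    (hPclose : ∀ σ : TPt d N' → ℂ, (∀ j, ‖σ j‖ ≤ Real.exp c.κ₁) →
      ∀ k l, ‖PB σ k l - PA σ k l‖ ≤ ϱ * (BE * Real.exp (-(ρ * tdist1 Nf (locΛ k) (locΛ l)))))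
    (hPloc : ∀ σ : TPt d N' → ℂ, (∀ j, ‖σ j‖ ≤ Real.exp c.κ₁) →
      ∀ k l, ‖(PB σ k l - PB 0 k l) - (PA σ k l - PA 0 k l)‖ ≤ ϱ * (DE' * Real.exp (-(ρ * distX X (locΛ k) (locΛ l)))))
    -- volume sums: `d₁`-currency (margin `η`) and bond pseudo-metric (margin `η_d`)
    (hvolp : ∀ i : p, ∑ k, Real.exp (-(η * tdist1 Nf (locp i) (locΛ k))) ≤ cV)
    (hvolΛ : ∀ i : Λ, ∑ k, Real.exp (-(η * tdist1 Nf (locΛ i) (locΛ k))) ≤ cV)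
    (hvolΛ' : ∀ j : Λ, ∑ k, Real.exp (-(η * tdist1 Nf (locΛ k) (locΛ j))) ≤ cV)
    (hvold : ∀ i : Λ, ∑ k, Real.exp (-(ηd * dist i k)) ≤ cVd) (hvold' : ∀ j : Λ, ∑ l, Real.exp (-(ηd * dist l j)) ≤ cVd) :
    ∀ σ : TPt d N' → ℂ, (∀ j, ‖σ j‖ ≤ Real.exp c.κ₁) →
      ∀ i j, ‖((KB σ * invSqrt (PB σ)) i j - (KB 0 * invSqrt (PB 0)) i j) - ((KA σ * invSqrt (PA σ)) i j - (KA 0 * invSqrt (PA 0)) i j)‖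
        ≤ ϱ * (((DK' * (2 / Real.sqrt m) + BK' * (4 * BE * cVd ^ 2 / (m * Real.sqrt m)) + DK * (4 * B₀ * cVd ^ 2 / (m * Real.sqrt m))
              + BK * (16 * BE * B₀ * cV ^ 4 / (m ^ 2 * Real.sqrt m) + 4 * DE' * cV ^ 2 / (m * Real.sqrt m))) * cV) *
            Real.exp (-(ρf * distX X (locp i) (locΛ j)))) := by
  have h0 := zero_mem_polydisc' (d := d) (N' := N') c
  -- rates
  set ρ₄ := ρf + η with hρ₄
  have hρ₄0 : 0 ≤ ρ₄ := by positivity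
  have hρ₄ρ : ρ₄ ≤ ρ := by simp only [hρ₄]; linarith
  have hρ₄split : ρ₄ + 4 * η ≤ ρ := by simp only [hρ₄]; linarith
  have hfsplit : ρf + η ≤ ρ₄ := le_rfl
  have hρ0 : 0 ≤ ρ := hρ₄0.trans hρ₄ρ
  have hρsθ : ρ * s ≤ θ := by linarith
  have hρs0 : 0 ≤ ρ * s := mul_nonneg hρ0 hs.le
  -- weakening helpers (plain and `ϱ * (D * e)` shapes)
  have wk : ∀ {q n : Type} {E : (TPt d N' → ℂ) → q → n → ℂ} {amp : ℝ} {w : q → n → ℝ}, 0 ≤ amp → (∀ k l, 0 ≤ w k l) →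
      (∀ σ : TPt d N' → ℂ, (∀ j, ‖σ j‖ ≤ Real.exp c.κ₁) → ∀ k l, ‖E σ k l‖ ≤ amp * Real.exp (-(ρ * w k l))) →
      ∀ σ : TPt d N' → ℂ, (∀ j, ‖σ j‖ ≤ Real.exp c.κ₁) → ∀ k l, ‖E σ k l‖ ≤ amp * Real.exp (-(ρ₄ * w k l)) :=
    fun hamp hw hM σ hσ k l => (hM σ hσ k l).trans
      (mul_le_mul_of_nonneg_left (Real.exp_le_exp.2 (neg_le_neg (mul_le_mul_of_nonneg_right hρ₄ρ (hw k l)))) hamp)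
  have wk' : ∀ {q n : Type} {E : (TPt d N' → ℂ) → q → n → ℂ} {amp : ℝ} {w : q → n → ℝ}, 0 ≤ amp → (∀ k l, 0 ≤ w k l) →
      (∀ σ : TPt d N' → ℂ, (∀ j, ‖σ j‖ ≤ Real.exp c.κ₁) → ∀ k l, ‖E σ k l‖ ≤ ϱ * (amp * Real.exp (-(ρ * w k l)))) →
      ∀ σ : TPt d N' → ℂ, (∀ j, ‖σ j‖ ≤ Real.exp c.κ₁) → ∀ k l, ‖E σ k l‖ ≤ ϱ * (amp * Real.exp (-(ρ₄ * w k l))) :=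
    fun hamp hw hM σ hσ k l => (hM σ hσ k l).trans (mul_le_mul_of_nonneg_left
      (mul_le_mul_of_nonneg_left (Real.exp_le_exp.2 (neg_le_neg (mul_le_mul_of_nonneg_right hρ₄ρ (hw k l)))) hamp) hϱ)
  -- (L1) of the run-B square root at decay `ρ₄` in `d₁`-currency
  have hrate : ∀ k l, ρ₄ * tdist1 Nf (locΛ k) (locΛ l) ≤ θ * (dist k l : ℝ) := by
    intro k l
    have hdkl : (0 : ℝ) ≤ dist k l := Nat.cast_nonneg _
    calc ρ₄ * tdist1 Nf (locΛ k) (locΛ l) ≤ ρ₄ * (s * dist k l) := mul_le_mul_of_nonneg_left (hloc k l) hρ₄0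
      _ ≤ ρ * (s * dist k l) := mul_le_mul_of_nonneg_right hρ₄ρ (by positivity)
      _ = (ρ * s) * dist k l := by ring
      _ ≤ θ * dist k l := mul_le_mul_of_nonneg_right hρsθ hdkl
  have hSB : ∀ σ : TPt d N' → ℂ, (∀ j, ‖σ j‖ ≤ Real.exp c.κ₁) →
      ∀ k l, ‖invSqrt (PB σ) k l‖ ≤ 2 / Real.sqrt m * Real.exp (-(ρ₄ * tdist1 Nf (locΛ k) (locΛ l))) := by
    intro σ hσ k l
    have h1 := norm_invSqrt_apply_le dist hd0 hds hdt (PB σ) (hrangeB σ hσ) h (hrowB σ hσ) (hcolB σ hσ) m θ hm hθ (haccB σ hσ) hhθ k l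
    exact h1.trans (mul_le_mul_of_nonneg_left (Real.exp_le_exp.2 (neg_le_neg (hrate k l))) (div_nonneg zero_le_two (Real.sqrt_nonneg _)))
  -- (L2) of the run-B square root at decay `ρ` through `X` (weight `d_X∕s`), then weakened to `ρ₄`
  have hSBloc : ∀ σ : TPt d N' → ℂ, (∀ j, ‖σ j‖ ≤ Real.exp c.κ₁) →
      ∀ k l, ‖invSqrt (PB σ) k l - invSqrt (PB 0) k l‖ ≤ 4 * B₀ * cVd ^ 2 / (m * Real.sqrt m) * Real.exp (-(ρ * distX X (locΛ k) (locΛ l))) := by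
    intro σ hσ k l
    set D : Λ → Λ → ℝ := fun a b => distX X (locΛ a) (locΛ b) / s with hDdef
    have hD0 : ∀ a b, 0 ≤ D a b := fun a b => div_nonneg (distX_nonneg X _ _) hs.le
    have hD : ∀ i a b j, D i j ≤ dist i a + D a b + dist b j := by
      intro i a b j
      have h1 := distX_le_tdist1_add hX (locΛ i) (locΛ a) (locΛ b) (locΛ j)
      have h2 : distX X (locΛ i) (locΛ j) ≤ s * dist i a + distX X (locΛ a) (locΛ b) + s * dist b j := by
        linarith [hloc i a, hloc b j]
      calc D i j = distX X (locΛ i) (locΛ j) / s := rfl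
        _ ≤ (s * dist i a + distX X (locΛ a) (locΛ b) + s * dist b j) / s := div_le_div_of_nonneg_right h2 hs.le
        _ = dist i a + D a b + dist b j := by simp only [hDdef]; field_simp
    have hE : ∀ a b, ‖(PB σ - PB 0) a b‖ ≤ B₀ * Real.exp (-(ρ * s * D a b)) := by
      intro a b
      have : ρ * s * D a b = ρ * distX X (locΛ a) (locΛ b) := by simp only [hDdef]; field_simp
      rw [this, Matrix.sub_apply]
      exact hPB' σ hσ a b
    have h2 := norm_invSqrt_sub_apply_le dist hd0 hds hdt (PB σ) (PB 0) (hrangeB σ hσ) (hrangeB 0 h0) h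
      (hrowB σ hσ) (hcolB σ hσ) (hrowB 0 h0) (hcolB 0 h0) m θ hm hθ (haccB σ hσ) (haccB 0 h0) hhθ D hD0 hD
      (B := B₀) (ρ := ρ * s) (η := ηd) (θ' := ρ * s) (cV := cVd) hB₀ hρs0 le_rfl hρθ hE hvold hvold' k l
    have hexp : Real.exp (-(ρ * s * D k l)) = Real.exp (-(ρ * distX X (locΛ k) (locΛ l))) := by
      congr 1; simp only [hDdef]; field_simp
    rw [← Matrix.sub_apply, ← hexp]
    exact h2
  -- (C1) of the square roots at decay `ρ` (part 2 §5), rewritten from `ρ·s∕s`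
  have hSclose₀ := close_invSqrt (c := c) locΛ PA PB dist hd0 hds hdt hs hloc hm hθ hhθ hBE hϱ hρs0 le_rfl hρθ hrangeA hrangeB hrowA hcolA hrowB hcolB
    haccA haccB hPclose hvold hvold'
  have hss : ρ * s / s = ρ := by field_simp
  have hSclose : ∀ σ : TPt d N' → ℂ, (∀ j, ‖σ j‖ ≤ Real.exp c.κ₁) →
      ∀ k l, ‖invSqrt (PB σ) k l - invSqrt (PA σ) k l‖ ≤ ϱ * ((4 * BE * cVd ^ 2 / (m * Real.sqrt m)) * Real.exp (-(ρ * tdist1 Nf (locΛ k) (locΛ l)))) := by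
    intro σ hσ k l
    have h1 := hSclose₀ σ hσ k l
    rwa [hss] at h1
  -- (C2) of the square roots at decay `ρ₄` (part 4 §8)
  have hSloc := locClose_invSqrt (c := c) locΛ PA PB dist hd0 hds hdt hloc hX hm hθ hhθ hBE hB₀ hDE' hϱ hρsθ hρ₄0 hη hρ₄split
    hrangeA hrangeB hrowA hcolA hrowB hcolB haccA haccB hPA' hPB' hPclose hPloc hvolΛ hvolΛ'
  -- feed part 1 §2 `locClose_mul`
  have hw₁p : ∀ (i : p) (k : Λ), 0 ≤ tdist1 Nf (locp i) (locΛ k) := fun _ _ => tdist1_nonneg _ _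
  have hwXp : ∀ (i : p) (k : Λ), 0 ≤ distX X (locp i) (locΛ k) := fun _ _ => distX_nonneg X _ _
  have hw₁Λ : ∀ (k l : Λ), 0 ≤ tdist1 Nf (locΛ k) (locΛ l) := fun _ _ => tdist1_nonneg _ _
  have hwXΛ : ∀ (k l : Λ), 0 ≤ distX X (locΛ k) (locΛ l) := fun _ _ => distX_nonneg X _ _
  exact locClose_mul (c := c) (locp := locp) (locq := locΛ) (locn := locΛ) (KA₁ := KA) (KB₁ := KB)
    (KA₂ := fun σ => invSqrt (PA σ)) (KB₂ := fun σ => invSqrt (PB σ)) hX hϱ hBK hBK' (div_nonneg zero_le_two (Real.sqrt_nonneg _))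
    (by positivity) hDK hDK' (by positivity) (by positivity) hρf hη hfsplit
    (wk hBK hw₁p hKA) (wk hBK' hwXp hKA') hSB (wk (by positivity) hwXΛ hSBloc)
    (wk' hDK hw₁p hKclose) (wk' hDK' hwXp hKloc) (wk' (by positivity) hw₁Λ hSclose)
    hSloc hvolp hvolΛ'

end GammaLoc

/-! ## §10 THE PROPAGATOR SHAPE «local factor × inverse precision»: (C1) and (C2) of `σ ↦ K(σ)·(A(σ))⁻¹` end to end -/

section PropShape

variable {p Λ : Type} [Fintype Λ] [DecidableEq Λ] {c : B13.Consts}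

/-- **(C1) OF THE PROPAGATOR SHAPE `σ ↦ K(σ)·(A(σ))⁻¹`** (a local factor times an inverted precision — the shape of every propagator-carrying factor
`G(σ) = Δ(σ)⁻¹` inside [Balaban1988RG2Cluster]'s `Δ_k(σ)`, read at two lattice spacings): part 1 `close_mul` ∘ part 2 `close_inv`.  From the local factor's
(L1) (`B_K`) and (C1) (`D_K`), the precisions' (C3) invertibility and NODE O's (L4) (`B_C`) for BOTH runs and their two-run (C1) (`D_E`), all at decay `ρ`,
`d₁`-currency volume sums `c_V` at margin `η` (rows of `p` and of `Λ`), output decay `ρ_f` with `ρ_f + 3η ≤ ρ`: (C1) at rate `ϱ`, amplitude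
`(D_K·B_C + B_K·(B_C²D_Ec_V²))·c_V`. [cite: King1986, p.665; Balaban1988RG2Cluster, (1.11) p.5, (2.16) p.16; Balaban1985BackgroundPropagators, Thm 3.10 p.416] -/
theorem close_mul_inv (locp : p → UT Nf) (locΛ : Λ → UT Nf)
    (KA KB : (TPt d N' → ℂ) → Matrix p Λ ℂ) (AA AB : (TPt d N' → ℂ) → Matrix Λ Λ ℂ)
    {ρ ρf η cV ϱ BK DK BC DE : ℝ} (hϱ : 0 ≤ ϱ) (hBK : 0 ≤ BK) (hDK : 0 ≤ DK) (hBC : 0 ≤ BC) (hDE : 0 ≤ DE)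
    (hρf : 0 ≤ ρf) (hη : 0 ≤ η) (hsplit : ρf + 3 * η ≤ ρ)
    (hKA : ∀ σ : TPt d N' → ℂ, (∀ j, ‖σ j‖ ≤ Real.exp c.κ₁) →
      ∀ i k, ‖KA σ i k‖ ≤ BK * Real.exp (-(ρ * tdist1 Nf (locp i) (locΛ k))))
    (hKclose : ∀ σ : TPt d N' → ℂ, (∀ j, ‖σ j‖ ≤ Real.exp c.κ₁) →
      ∀ i k, ‖KB σ i k - KA σ i k‖ ≤ ϱ * (DK * Real.exp (-(ρ * tdist1 Nf (locp i) (locΛ k)))))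
    (hinvA : ∀ σ : TPt d N' → ℂ, (∀ j, ‖σ j‖ ≤ Real.exp c.κ₁) → AA σ * (AA σ)⁻¹ = 1)
    (hinvB : ∀ σ : TPt d N' → ℂ, (∀ j, ‖σ j‖ ≤ Real.exp c.κ₁) → AB σ * (AB σ)⁻¹ = 1)
    (hC4A : ∀ σ : TPt d N' → ℂ, (∀ j, ‖σ j‖ ≤ Real.exp c.κ₁) →
      ∀ i k, ‖(AA σ)⁻¹ i k‖ ≤ BC * Real.exp (-(ρ * tdist1 Nf (locΛ i) (locΛ k))))
    (hC4B : ∀ σ : TPt d N' → ℂ, (∀ j, ‖σ j‖ ≤ Real.exp c.κ₁) →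
      ∀ i k, ‖(AB σ)⁻¹ i k‖ ≤ BC * Real.exp (-(ρ * tdist1 Nf (locΛ i) (locΛ k))))
    (hAclose : ∀ σ : TPt d N' → ℂ, (∀ j, ‖σ j‖ ≤ Real.exp c.κ₁) →
      ∀ i k, ‖AB σ i k - AA σ i k‖ ≤ ϱ * (DE * Real.exp (-(ρ * tdist1 Nf (locΛ i) (locΛ k)))))
    (hvolp : ∀ i : p, ∑ k, Real.exp (-(η * tdist1 Nf (locp i) (locΛ k))) ≤ cV)
    (hvolΛ : ∀ i : Λ, ∑ k, Real.exp (-(η * tdist1 Nf (locΛ i) (locΛ k))) ≤ cV) :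
    ∀ σ : TPt d N' → ℂ, (∀ j, ‖σ j‖ ≤ Real.exp c.κ₁) →
      ∀ i j, ‖(KB σ * (AB σ)⁻¹) i j - (KA σ * (AA σ)⁻¹) i j‖
        ≤ ϱ * (((DK * BC + BK * (BC ^ 2 * DE * cV ^ 2)) * cV) * Real.exp (-(ρf * tdist1 Nf (locp i) (locΛ j)))) := by
  set ρ₂ := ρf + η with hρ₂
  have hρ₂0 : 0 ≤ ρ₂ := by positivity
  have hρ₂ρ : ρ₂ ≤ ρ := by simp only [hρ₂]; linarith
  have hρ₂split : ρ₂ + 2 * η ≤ ρ := by simp only [hρ₂]; linarith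
  have wkd : ∀ {q n : Type} {E : (TPt d N' → ℂ) → q → n → ℂ} {amp : ℝ} {lq : q → UT Nf} {ln : n → UT Nf}, 0 ≤ amp →
      (∀ σ : TPt d N' → ℂ, (∀ j, ‖σ j‖ ≤ Real.exp c.κ₁) → ∀ k l, ‖E σ k l‖ ≤ amp * Real.exp (-(ρ * tdist1 Nf (lq k) (ln l)))) →
      ∀ σ : TPt d N' → ℂ, (∀ j, ‖σ j‖ ≤ Real.exp c.κ₁) → ∀ k l, ‖E σ k l‖ ≤ amp * Real.exp (-(ρ₂ * tdist1 Nf (lq k) (ln l))) :=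
    fun hamp hM σ hσ k l => (hM σ hσ k l).trans
      (mul_le_mul_of_nonneg_left (Real.exp_le_exp.2 (neg_le_neg (mul_le_mul_of_nonneg_right hρ₂ρ (tdist1_nonneg _ _)))) hamp)
  have hIclose := close_inv (c := c) (locΛ := locΛ) (AA := AA) (AB := AB) hϱ hDE hBC hρ₂0 hη hρ₂split hinvA hinvB hC4A hC4B hAclose hvolΛ
  have hKclose₂ : ∀ σ : TPt d N' → ℂ, (∀ j, ‖σ j‖ ≤ Real.exp c.κ₁) →
      ∀ i k, ‖KB σ i k - KA σ i k‖ ≤ ϱ * (DK * Real.exp (-(ρ₂ * tdist1 Nf (locp i) (locΛ k)))) := fun σ hσ i k =>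
    (hKclose σ hσ i k).trans (mul_le_mul_of_nonneg_left (mul_le_mul_of_nonneg_left
      (Real.exp_le_exp.2 (neg_le_neg (mul_le_mul_of_nonneg_right hρ₂ρ (tdist1_nonneg _ _)))) hDK) hϱ)
  exact close_mul (c := c) (locp := locp) (locq := locΛ) (locn := locΛ) (KA₁ := KA) (KB₁ := KB)
    (KA₂ := fun σ => (AA σ)⁻¹) (KB₂ := fun σ => (AB σ)⁻¹) hϱ hBK hBC hDK (by positivity) hρf hη le_rfl
    (wkd hBK hKA) (wkd hBC hC4B) hKclose₂ hIclose hvolp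

/-- **(C2) OF THE PROPAGATOR SHAPE `σ ↦ K(σ)·(A(σ))⁻¹`, END TO END**: part 1 `locClose_mul` fed with the local factor's four letters ((L1) `B_K`, (L2) `B_K′`,
(C1) `D_K`, (C2) `D_K′`) and, for the inverse precision: (L1) = NODE O's (L4) (`B_C`), (L2) `B_C²B_E′c_V²` (here: `A(σ)⁻¹ − A(0)⁻¹ = A(σ)⁻¹(A(0) − A(σ))A(0)⁻¹`
localised through `X` by part 1 §1), (C1) `B_C²D_Ec_V²` (part 2 `close_inv`), (C2) `2B_C³B_E′D_Ec_V⁴ + B_C²D_E′c_V²` (part 3 `locClose_inv`).  All input letters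
at ONE decay `ρ`; `d₁`-currency volume sums `c_V` at margin `η` (rows of `p`, rows and columns of `Λ`); output decay `ρ_f` with `ρ_f + 5η ≤ ρ`; amplitude
`(D_K′·B_C + B_K′·(B_C²D_Ec_V²) + D_K·(B_C²B_E′c_V²) + B_K·(2B_C³B_E′D_Ec_V⁴ + B_C²D_E′c_V²))·c_V` — the END's `hlocΓ`-type binder for a kernel of this shape
from the letters of its primitives. [cite: King1986, p.665; Balaban1988RG2Cluster, (1.11) p.5, p.13, (2.16) p.16; Balaban1985BackgroundPropagators, (3.93) p.410, Thm 3.10 p.416] -/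
theorem locClose_mul_inv (locp : p → UT Nf) (locΛ : Λ → UT Nf)
    (KA KB : (TPt d N' → ℂ) → Matrix p Λ ℂ) (AA AB : (TPt d N' → ℂ) → Matrix Λ Λ ℂ) {X : Finset (UT Nf)} (hX : X.Nonempty)
    {ρ ρf η cV ϱ BK BK' DK DK' BC BE' DE DE' : ℝ} (hϱ : 0 ≤ ϱ) (hBK : 0 ≤ BK) (hBK' : 0 ≤ BK') (hDK : 0 ≤ DK) (hDK' : 0 ≤ DK')
    (hBC : 0 ≤ BC) (hBE' : 0 ≤ BE') (hDE : 0 ≤ DE) (hDE' : 0 ≤ DE')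
    (hρf : 0 ≤ ρf) (hη : 0 ≤ η) (hsplit : ρf + 5 * η ≤ ρ)
    (hKA : ∀ σ : TPt d N' → ℂ, (∀ j, ‖σ j‖ ≤ Real.exp c.κ₁) →
      ∀ i k, ‖KA σ i k‖ ≤ BK * Real.exp (-(ρ * tdist1 Nf (locp i) (locΛ k))))
    (hKA' : ∀ σ : TPt d N' → ℂ, (∀ j, ‖σ j‖ ≤ Real.exp c.κ₁) →
      ∀ i k, ‖KA σ i k - KA 0 i k‖ ≤ BK' * Real.exp (-(ρ * distX X (locp i) (locΛ k))))
    (hKclose : ∀ σ : TPt d N' → ℂ, (∀ j, ‖σ j‖ ≤ Real.exp c.κ₁) →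
      ∀ i k, ‖KB σ i k - KA σ i k‖ ≤ ϱ * (DK * Real.exp (-(ρ * tdist1 Nf (locp i) (locΛ k)))))
    (hKloc : ∀ σ : TPt d N' → ℂ, (∀ j, ‖σ j‖ ≤ Real.exp c.κ₁) →
      ∀ i k, ‖(KB σ i k - KB 0 i k) - (KA σ i k - KA 0 i k)‖ ≤ ϱ * (DK' * Real.exp (-(ρ * distX X (locp i) (locΛ k)))))
    (hinvA : ∀ σ : TPt d N' → ℂ, (∀ j, ‖σ j‖ ≤ Real.exp c.κ₁) → AA σ * (AA σ)⁻¹ = 1)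
    (hinvB : ∀ σ : TPt d N' → ℂ, (∀ j, ‖σ j‖ ≤ Real.exp c.κ₁) → AB σ * (AB σ)⁻¹ = 1)
    (hC4A : ∀ σ : TPt d N' → ℂ, (∀ j, ‖σ j‖ ≤ Real.exp c.κ₁) →
      ∀ i k, ‖(AA σ)⁻¹ i k‖ ≤ BC * Real.exp (-(ρ * tdist1 Nf (locΛ i) (locΛ k))))
    (hC4B : ∀ σ : TPt d N' → ℂ, (∀ j, ‖σ j‖ ≤ Real.exp c.κ₁) →
      ∀ i k, ‖(AB σ)⁻¹ i k‖ ≤ BC * Real.exp (-(ρ * tdist1 Nf (locΛ i) (locΛ k))))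
    (hA' : ∀ σ : TPt d N' → ℂ, (∀ j, ‖σ j‖ ≤ Real.exp c.κ₁) →
      ∀ i k, ‖AA σ i k - AA 0 i k‖ ≤ BE' * Real.exp (-(ρ * distX X (locΛ i) (locΛ k))))
    (hB' : ∀ σ : TPt d N' → ℂ, (∀ j, ‖σ j‖ ≤ Real.exp c.κ₁) →
      ∀ i k, ‖AB σ i k - AB 0 i k‖ ≤ BE' * Real.exp (-(ρ * distX X (locΛ i) (locΛ k))))
    (hAclose : ∀ σ : TPt d N' → ℂ, (∀ j, ‖σ j‖ ≤ Real.exp c.κ₁) →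
      ∀ i k, ‖AB σ i k - AA σ i k‖ ≤ ϱ * (DE * Real.exp (-(ρ * tdist1 Nf (locΛ i) (locΛ k)))))
    (hAloc : ∀ σ : TPt d N' → ℂ, (∀ j, ‖σ j‖ ≤ Real.exp c.κ₁) →
      ∀ i k, ‖(AB σ i k - AB 0 i k) - (AA σ i k - AA 0 i k)‖ ≤ ϱ * (DE' * Real.exp (-(ρ * distX X (locΛ i) (locΛ k)))))
    (hvolp : ∀ i : p, ∑ k, Real.exp (-(η * tdist1 Nf (locp i) (locΛ k))) ≤ cV)
    (hvolΛ : ∀ i : Λ, ∑ k, Real.exp (-(η * tdist1 Nf (locΛ i) (locΛ k))) ≤ cV)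
    (hvolΛ' : ∀ j : Λ, ∑ k, Real.exp (-(η * tdist1 Nf (locΛ k) (locΛ j))) ≤ cV) :
    ∀ σ : TPt d N' → ℂ, (∀ j, ‖σ j‖ ≤ Real.exp c.κ₁) →
      ∀ i j, ‖((KB σ * (AB σ)⁻¹) i j - (KB 0 * (AB 0)⁻¹) i j) - ((KA σ * (AA σ)⁻¹) i j - (KA 0 * (AA 0)⁻¹) i j)‖
        ≤ ϱ * (((DK' * BC + BK' * (BC ^ 2 * DE * cV ^ 2) + DK * (BC ^ 2 * BE' * cV ^ 2)
              + BK * (2 * BC ^ 3 * BE' * DE * cV ^ 4 + BC ^ 2 * DE' * cV ^ 2)) * cV) *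
            Real.exp (-(ρf * distX X (locp i) (locΛ j)))) := by
  have h0 := zero_mem_polydisc' (d := d) (N' := N') c
  set ρ₄ := ρf + η with hρ₄
  have hρ₄0 : 0 ≤ ρ₄ := by positivity
  have hρ₄ρ : ρ₄ ≤ ρ := by simp only [hρ₄]; linarith
  have hρ₄2 : ρ₄ + 2 * η ≤ ρ := by simp only [hρ₄]; linarith
  have hρ₄4 : ρ₄ + 4 * η ≤ ρ := by simp only [hρ₄]; linarith
  -- weakening to the common rate `ρ₄`
  have wk : ∀ {q n : Type} {E : (TPt d N' → ℂ) → q → n → ℂ} {amp : ℝ} {w : q → n → ℝ}, 0 ≤ amp → (∀ k l, 0 ≤ w k l) →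
      (∀ σ : TPt d N' → ℂ, (∀ j, ‖σ j‖ ≤ Real.exp c.κ₁) → ∀ k l, ‖E σ k l‖ ≤ amp * Real.exp (-(ρ * w k l))) →
      ∀ σ : TPt d N' → ℂ, (∀ j, ‖σ j‖ ≤ Real.exp c.κ₁) → ∀ k l, ‖E σ k l‖ ≤ amp * Real.exp (-(ρ₄ * w k l)) :=
    fun hamp hw hM σ hσ k l => (hM σ hσ k l).trans
      (mul_le_mul_of_nonneg_left (Real.exp_le_exp.2 (neg_le_neg (mul_le_mul_of_nonneg_right hρ₄ρ (hw k l)))) hamp)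
  have wk' : ∀ {q n : Type} {E : (TPt d N' → ℂ) → q → n → ℂ} {amp : ℝ} {w : q → n → ℝ}, 0 ≤ amp → (∀ k l, 0 ≤ w k l) →
      (∀ σ : TPt d N' → ℂ, (∀ j, ‖σ j‖ ≤ Real.exp c.κ₁) → ∀ k l, ‖E σ k l‖ ≤ ϱ * (amp * Real.exp (-(ρ * w k l)))) →
      ∀ σ : TPt d N' → ℂ, (∀ j, ‖σ j‖ ≤ Real.exp c.κ₁) → ∀ k l, ‖E σ k l‖ ≤ ϱ * (amp * Real.exp (-(ρ₄ * w k l))) :=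
    fun hamp hw hM σ hσ k l => (hM σ hσ k l).trans (mul_le_mul_of_nonneg_left
      (mul_le_mul_of_nonneg_left (Real.exp_le_exp.2 (neg_le_neg (mul_le_mul_of_nonneg_right hρ₄ρ (hw k l)))) hamp) hϱ)
  have hw₁p : ∀ (i : p) (k : Λ), 0 ≤ tdist1 Nf (locp i) (locΛ k) := fun _ _ => tdist1_nonneg _ _
  have hwXp : ∀ (i : p) (k : Λ), 0 ≤ distX X (locp i) (locΛ k) := fun _ _ => distX_nonneg X _ _
  have hw₁Λ : ∀ (k l : Λ), 0 ≤ tdist1 Nf (locΛ k) (locΛ l) := fun _ _ => tdist1_nonneg _ _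
  have hwXΛ : ∀ (k l : Λ), 0 ≤ distX X (locΛ k) (locΛ l) := fun _ _ => distX_nonneg X _ _
  -- (L2) of the run-B inverse: `A_B(σ)⁻¹ − A_B(0)⁻¹ = A_B(σ)⁻¹ (A_B(0) − A_B(σ)) A_B(0)⁻¹`, localised through `X`, at rate `ρ₄`
  have hr₁ρ : (ρ₄ + η) + η ≤ ρ := by linarith
  have hIBloc : ∀ σ : TPt d N' → ℂ, (∀ j, ‖σ j‖ ≤ Real.exp c.κ₁) →
      ∀ k l, ‖(AB σ)⁻¹ k l - (AB 0)⁻¹ k l‖ ≤ BC ^ 2 * BE' * cV ^ 2 * Real.exp (-(ρ₄ * distX X (locΛ k) (locΛ l))) := by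
    intro σ hσ k l
    have hUσ : IsUnit (AB σ) := (Matrix.isUnit_iff_isUnit_det _).2 (Matrix.isUnit_det_of_right_inverse (hinvB σ hσ))
    have hU0 : IsUnit (AB 0) := (Matrix.isUnit_iff_isUnit_det _).2 (Matrix.isUnit_det_of_right_inverse (hinvB 0 h0))
    have hres : (AB σ)⁻¹ - (AB 0)⁻¹ = (AB σ)⁻¹ * (AB 0 - AB σ) * (AB 0)⁻¹ := Matrix.inv_sub_inv (iff_of_true hUσ hU0)
    have e : ∀ a b, ‖(AB 0 - AB σ) a b‖ ≤ BE' * Real.exp (-(ρ * distX X (locΛ a) (locΛ b))) := fun a b => by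
      rw [Matrix.sub_apply, norm_sub_rev]; exact hB' σ hσ a b
    have s1 := norm_mul_apply_le_of_decayX_right locΛ locΛ locΛ hX (M₁ := (AB σ)⁻¹) (M₂ := AB 0 - AB σ) (a := BC) (b := BE')
      hBC hBE' (by positivity : 0 ≤ ρ₄ + η) hη hr₁ρ (hC4B σ hσ) e hvolΛ
    have hR0 : ∀ a b, ‖(AB 0)⁻¹ a b‖ ≤ BC * Real.exp (-((ρ₄ + η) * tdist1 Nf (locΛ a) (locΛ b))) := fun a b =>
      (hC4B 0 h0 a b).trans (mul_le_mul_of_nonneg_left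
        (Real.exp_le_exp.2 (neg_le_neg (mul_le_mul_of_nonneg_right (by linarith) (tdist1_nonneg _ _)))) hBC)
    have s2 := norm_mul_apply_le_of_decayX_left locΛ locΛ locΛ hX (M₁ := (AB σ)⁻¹ * (AB 0 - AB σ)) (M₂ := (AB 0)⁻¹)
      (a := BC * BE' * cV) (b := BC) (by
        have hcV : 0 ≤ cV := (Finset.sum_nonneg fun k _ => (Real.exp_pos _).le).trans (hvolΛ k)
        positivity) hBC hρ₄0 hη le_rfl s1 hR0 hvolΛ' k l
    rw [← Matrix.sub_apply, hres]
    exact s2.trans_eq (by ring)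
  -- (C1), (C2) of the inverses at rate `ρ₄` (parts 2, 3)
  have hIclose := close_inv (c := c) (locΛ := locΛ) (AA := AA) (AB := AB) hϱ hDE hBC hρ₄0 hη hρ₄2 hinvA hinvB hC4A hC4B hAclose hvolΛ
  have hIloc := locClose_inv (c := c) (locΛ := locΛ) (AA := AA) (AB := AB) hX hϱ hBC hBE' hDE hDE' hρ₄0 hη hρ₄4 hinvA hinvB hC4A hC4B
    hA' hB' hAclose hAloc hvolΛ hvolΛ'
  exact locClose_mul (c := c) (locp := locp) (locq := locΛ) (locn := locΛ) (KA₁ := KA) (KB₁ := KB)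
    (KA₂ := fun σ => (AA σ)⁻¹) (KB₂ := fun σ => (AB σ)⁻¹) hX hϱ hBK hBK' hBC (by positivity) hDK hDK' (by positivity) (by positivity) hρf hη le_rfl
    (wk hBK hw₁p hKA) (wk hBK' hwXp hKA') (wk hBC hw₁Λ hC4B) hIBloc
    (wk' hDK hw₁p hKclose) (wk' hDK' hwXp hKloc) hIclose hIloc hvolp hvolΛ'

end PropShape

end Summit.QuantumFields.YangMills.BalabanUVNodes.N18TwoRunLettersCalculusGammaLoc

end
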